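import Literature.NumberTheory.PAdicHodge.UnramifiedWittVectors
import Literature.NumberTheory.PAdicHodge.CyclotomicTilt
import Literature.NumberTheory.PAdicHodge.BdRPlusEmbedding
import Literature.NumberTheory.GaloisRepresentations.UnramifiedPeriodMatrix
import Literature.NumberTheory.GaloisRepresentations.UnramifiedAdmissible
import Mathlib.RingTheory.WittVector.Compare
import Mathlib.RingTheory.WittVector.Complete
import HarnessLib

/-!
# The period matrix of an unramified `p`-adic representation over `W(k̄)`

Let `F` be a non-archimedean local field of characteristic `0` and residue characteristic `p`,
`k̄ = ResidueField 𝒪̂_{F^nr}` (algebraically closed of characteristic `p`, file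
`UnramifiedWittVectors`) with the action `σ̄ = residueGal σ` of `Γ_F = Gal(F̄/F)`, and
`W(k̄) = 𝕎 k̄` its ring of Witt vectors with the induced action `𝕎(σ̄)` (`wittGal σ`).  For a
continuous **unramified** `r : Γ_F →ₜ* GL_N(ℤ_p)` (trivial on the inertia group) we view `r σ` as an
invertible matrix `R(σ)` over `W(k̄)` through `ℤ_p = W(𝔽_p) → W(k̄)` (`padicIntToWitt`).  Main result:

* `exists_isUnit_forall_eq_mul_wittGal` — **there is an invertible `X ∈ M_N(W(k̄))` with
  `X = R(σ) · 𝕎(σ̄)(X)` for every `σ ∈ Γ_F`**: unramified representations of `Γ_F` become trivial over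
  `W(k̄) = 𝒪_{F̂₀^nr}` (Fontaine 1994, Exp. III §1.5–1.6 / Fontaine–Ouyang Prop. 2.14, Thm. 2.13 with
  `P₀ = W(k̄)[1/p]`; Serre, *Local Fields*, Ch. XIII §5, Lang's theorem).
* `PeriodRingData.isAdmissible_of_unramified_witt` — consequently, for every period-ring datum `𝔅`
  (`PeriodRingData` over `(ℚ_p, Γ_F)` with invariants `F`) receiving a `Γ_F`-equivariant ring map
  `ι : W(k̄) → B` compatible with `ℤ_p → ℚ_p → B`, **every unramified continuous representation of
  `Γ_F` on a finite-dimensional `ℚ_p`-vector space is `𝔅`-admissible** — the form needed for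
  `B_cris ⊇ W(k̄)` and `B_dR ⊇ 𝔸_inf ⊇ W(k̄)` (clause F3 of `IsFontaineDatum`), which, unlike the
  earlier `PeriodRingData.isAdmissible_of_unramified` (file `UnramifiedAdmissible`, `ι : 𝒪̂_{F^nr} → B`),
  does not ask `B` to receive the ramified ring `𝒪̂_{F^nr}`.

This is the `W(k̄)`-form of `exists_isUnit_forall_eq_mul_galAut` (file `UnramifiedPeriodMatrix`, over
`𝒪̂_{F^nr} = W(k̄) ⊗ 𝒪_F`), whose proof is followed verbatim: Lang's theorem over the `p`-adically
complete ring `W(k̄)` with algebraically closed residue field (`FrobeniusSemilinear.exists_isUnit_eq_mul_map`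
with `π = p`, `res = constantCoeff`, `φ = 𝕎(σ̄₀)` for an arithmetic Frobenius `σ₀`, which acts on `k̄`
as `y ↦ y^q`) gives `X = R(σ₀) 𝕎(σ̄₀)(X)`; for general `σ` and each level `m`, the finitely many Witt
components of `X` below `m` lie in `k̄ = 𝒪_{F^nr}/𝔪`, so `σ̄` agrees with some `σ̄₀ᵃ` on them while
`(σ₀ᵃ)⁻¹ σ` lies in the open kernel of `r mod pᵐ` (`exists_forall_smul_eq_pow_and_mem`); hence
`R(σ) 𝕎(σ̄)(X) ≡ X (mod pᵐ)` for all `m`.  The point of the `W(k̄)`-form: `W(k̄)` maps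
`Γ_F`-equivariantly into `𝔸_inf(F) ⊆ B_dR⁺(F)` and into `A_cris` (`wittToAinf`), whereas the
ramified ring `𝒪̂_{F^nr}` does not.

Definitions: `residueGal`-action lemmas, `wittGal`, `wittGalMatrix`, `padicIntToWitt`, `wittPeriodCoeff`;
two abstract matrix lemmas (`map_pow_eq_pow_mul_of_eq_mul_map`, `MatCong.self_of_map_cong_of_cong_one`)
isolating the pure algebra of the descent from `σ₀` to all of `Γ_F`. No named facts.

## References
* [FontaineAsterisque223III] J.-M. Fontaine, Astérisque 223 (1994), Exp. III §1.5–§1.6.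
* [SerreLocalFields1979] J.-P. Serre, *Local Fields*, GTM 67, Ch. XIII §5.
* [FontaineOuyang2022] J.-M. Fontaine, Y. Ouyang, *Theory of p-adic Galois representations*, Prop. 2.14, Thm. 2.13.
-/

noncomputable section

open WittVector IsLocalRing Matrix Field ValuativeRel
open scoped ValuativeRel MatrixGroups TensorProduct

namespace Literature.NumberTheory.PAdicHodge

open Literature.NumberTheory.GaloisRepresentations
open Literature.NumberTheory.GaloisRepresentations.IsNonarchimedeanLocalField

variable {F : Type} [Field F] [ValuativeRel F] [TopologicalSpace F] [IsNonarchimedeanLocalField F]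
  {p : ℕ} [Fact p.Prime]

/-! ### The action of `Γ_F` on `k̄` and on `W(k̄)` -/

omit [Fact p.Prime] in
/-- `residueGal 1 = id`. [folklore] -/
theorem residueGal_one (y : (IsLocalRing.ResidueField (maxUnramifiedCompletion F))) : residueGal (1 : absoluteGaloisGroup F) y = y := by
  obtain ⟨a, rfl⟩ := IsLocalRing.residue_surjective y
  rw [residueGal_residue, map_one, RingAut.one_apply]

omit [Fact p.Prime] in
/-- `residueGal (σ τ) = residueGal σ ∘ residueGal τ`. [folklore] -/
theorem residueGal_mul (σ τ : absoluteGaloisGroup F) (y : (IsLocalRing.ResidueField (maxUnramifiedCompletion F))) :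
    residueGal (σ * τ) y = residueGal σ (residueGal τ y) := by
  obtain ⟨a, rfl⟩ := IsLocalRing.residue_surjective y
  rw [residueGal_residue, residueGal_residue, residueGal_residue, map_mul, RingAut.mul_apply]

omit [Fact p.Prime] in
/-- **The inertia group acts trivially on `k̄`.** [folklore] -/
theorem residueGal_eq_self_of_mem_absInertia {σ : absoluteGaloisGroup F} (hσ : σ ∈ absInertia F) (y : (IsLocalRing.ResidueField (maxUnramifiedCompletion F))) :
    residueGal σ y = y := by
  obtain ⟨a, rfl⟩ := IsLocalRing.residue_surjective y
  rw [residueGal_residue, maxUnramifiedCompletion.galAut_eq_self_of_mem_absInertia hσ]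

omit [Fact p.Prime] in
/-- **An arithmetic Frobenius acts on `k̄` as `y ↦ y ^ q`.** [cite: SerreLocalFields1979, Ch. IV §4 Prop. 16] -/
theorem IsAbsArithFrob.residueGal_eq_pow {σ₀ : absoluteGaloisGroup F} (hσ₀ : IsAbsArithFrob σ₀) (y : (IsLocalRing.ResidueField (maxUnramifiedCompletion F))) :
    residueGal σ₀ y = y ^ residueFieldCard F := by
  obtain ⟨a, rfl⟩ := IsLocalRing.residue_surjective y
  rw [residueGal_residue, ← map_pow, ← sub_eq_zero, ← map_sub, IsLocalRing.residue_eq_zero_iff]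
  exact IsAbsArithFrob.galAut_sub_pow_mem_maximalIdeal hσ₀ a

omit [Fact p.Prime] in
/-- `σ̄ (res (ι b)) = res (ι (σ • b))` for `b ∈ 𝒪_{F^nr}`. [folklore] -/
theorem residueGal_residue_algebraMap (σ : absoluteGaloisGroup F) (b : maxUnramifiedIntegers F) :
    residueGal σ (IsLocalRing.residue _ (algebraMap (maxUnramifiedIntegers F) (maxUnramifiedCompletion F) b)) =
      IsLocalRing.residue _ (algebraMap (maxUnramifiedIntegers F) (maxUnramifiedCompletion F) (σ • b)) := by
  rw [residueGal_residue, maxUnramifiedCompletion.galAut_algebraMap']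

omit [Fact p.Prime] in
/-- Every element of `k̄` is the residue of an element of `𝒪_{F^nr} ⊆ F̄`. [cite: SerreLocalFields1979, Ch. IV §4 Cor. 2 to Prop. 16] -/
theorem exists_residue_algebraMap_eq (y : (IsLocalRing.ResidueField (maxUnramifiedCompletion F))) :
    ∃ b : maxUnramifiedIntegers F,
      IsLocalRing.residue _ (algebraMap (maxUnramifiedIntegers F) (maxUnramifiedCompletion F) b) = y := by
  obtain ⟨z, rfl⟩ := (maxUnramifiedCompletion.residueFieldEquiv F).surjective y
  obtain ⟨b, rfl⟩ := IsLocalRing.residue_surjective z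
  exact ⟨b, (maxUnramifiedCompletion.residueFieldEquiv_residue F b).symm⟩

/-- **The action `𝕎(σ̄)` of `σ ∈ Γ_F` on `W(k̄)`** (Witt functoriality). [cite: FontaineAsterisque223III, Exp. II §1.2] -/
def wittGal (σ : absoluteGaloisGroup F) : WittVector p (IsLocalRing.ResidueField (maxUnramifiedCompletion F)) →+* WittVector p (IsLocalRing.ResidueField (maxUnramifiedCompletion F)) :=
  WittVector.map (residueGal σ)

/-- Witt components of `𝕎(σ̄) x`. [folklore] -/
@[simp] theorem coeff_wittGal (σ : absoluteGaloisGroup F) (x : WittVector p (IsLocalRing.ResidueField (maxUnramifiedCompletion F))) (n : ℕ) :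
    (wittGal σ x).coeff n = residueGal σ (x.coeff n) :=
  WittVector.map_coeff _ _ _

/-- `wittGal 1 = id`. [folklore] -/
theorem wittGal_one (x : WittVector p (IsLocalRing.ResidueField (maxUnramifiedCompletion F))) : wittGal (1 : absoluteGaloisGroup F) x = x :=
  WittVector.ext fun n => by rw [coeff_wittGal, residueGal_one]

/-- `wittGal (σ τ) = wittGal σ ∘ wittGal τ`. [folklore] -/
theorem wittGal_mul (σ τ : absoluteGaloisGroup F) (x : WittVector p (IsLocalRing.ResidueField (maxUnramifiedCompletion F))) :
    wittGal (σ * τ) x = wittGal σ (wittGal τ x) :=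
  WittVector.ext fun n => by rw [coeff_wittGal, coeff_wittGal, coeff_wittGal, residueGal_mul]

/-- `𝕎(σ̄)` maps `(p)^m` into itself. [folklore] -/
theorem wittGal_mem_span_pow (σ : absoluteGaloisGroup F) (m : ℕ) {x : WittVector p (IsLocalRing.ResidueField (maxUnramifiedCompletion F))}
    (hx : x ∈ Ideal.span {(p : WittVector p (IsLocalRing.ResidueField (maxUnramifiedCompletion F)))} ^ m) : wittGal σ x ∈ Ideal.span {(p : WittVector p (IsLocalRing.ResidueField (maxUnramifiedCompletion F)))} ^ m :=
  map_mem_span_natCast_pow (O := WittVector p (IsLocalRing.ResidueField (maxUnramifiedCompletion F)))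
    (O' := WittVector p (IsLocalRing.ResidueField (maxUnramifiedCompletion F))) (wittGal (p := p) σ) m hx

/-- `wittGal σ` fixes `p`. [folklore] -/
theorem wittGal_natCast (σ : absoluteGaloisGroup F) (n : ℕ) : wittGal σ (n : WittVector p (IsLocalRing.ResidueField (maxUnramifiedCompletion F))) = n :=
  map_natCast _ n

variable {N : ℕ}

/-- The Galois action on matrices over `W(k̄)` (entrywise). [folklore] -/
def wittGalMatrix (τ : absoluteGaloisGroup F) :
    Matrix (Fin N) (Fin N) (WittVector p (IsLocalRing.ResidueField (maxUnramifiedCompletion F))) →+* Matrix (Fin N) (Fin N) (WittVector p (IsLocalRing.ResidueField (maxUnramifiedCompletion F))) :=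
  (wittGal (p := p) τ).mapMatrix

/-- Unfolding lemma for `wittGalMatrix`. [folklore] -/
theorem wittGalMatrix_apply (τ : absoluteGaloisGroup F) (Y : Matrix (Fin N) (Fin N) (WittVector p (IsLocalRing.ResidueField (maxUnramifiedCompletion F)))) (i j : Fin N) :
    wittGalMatrix τ Y i j = wittGal τ (Y i j) := rfl

/-- `wittGalMatrix` is multiplicative in the group element. [folklore] -/
theorem wittGalMatrix_mul (τ τ' : absoluteGaloisGroup F) (Y : Matrix (Fin N) (Fin N) (WittVector p (IsLocalRing.ResidueField (maxUnramifiedCompletion F)))) :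
    wittGalMatrix (τ * τ') Y = wittGalMatrix τ (wittGalMatrix τ' Y) :=
  Matrix.ext fun i j => by simp only [wittGalMatrix_apply, wittGal_mul]

/-- `wittGalMatrix 1 = id`. [folklore] -/
theorem wittGalMatrix_one (Y : Matrix (Fin N) (Fin N) (WittVector p (IsLocalRing.ResidueField (maxUnramifiedCompletion F)))) :
    wittGalMatrix (1 : absoluteGaloisGroup F) Y = Y :=
  Matrix.ext fun i j => by simp only [wittGalMatrix_apply, wittGal_one]

/-! ### Two abstract matrix lemmas (pure algebra) -/

section Abstract

variable {A : Type*} [CommRing A] {Γ : Type*}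

/-- **Iterating a Frobenius relation.** For a family `gal` of ring endomorphisms of `M_N(A)` indexed
by a monoid `Γ` with `gal 1 = id`, `gal (σ τ) = gal σ ∘ gal τ`: if `V · R = 1`, every `gal τ` fixes
`R` and `X = R · gal σ₀ (X)`, then `gal (σ₀ ^ a) X = V ^ a · X`. [folklore] -/
theorem map_pow_eq_pow_mul_of_eq_mul_map [Monoid Γ]
    (gal : Γ → Matrix (Fin N) (Fin N) A →+* Matrix (Fin N) (Fin N) A)
    (gal_one : ∀ Y, gal 1 Y = Y) (gal_mul : ∀ σ τ Y, gal (σ * τ) Y = gal σ (gal τ Y))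
    {σ₀ : Γ} {R V X : Matrix (Fin N) (Fin N) A} (hVR : V * R = 1) (hR : ∀ τ, gal τ R = R)
    (hX : X = R * gal σ₀ X) (a : ℕ) : gal (σ₀ ^ a) X = V ^ a * X := by
  have hRV : R * V = 1 := mul_eq_one_comm.1 hVR
  have hφX : gal σ₀ X = V * X := by
    calc gal σ₀ X = V * R * gal σ₀ X := by rw [hVR, Matrix.one_mul]
      _ = V * X := by rw [Matrix.mul_assoc, ← hX]
  have hφV : ∀ τ, gal τ V = V := fun τ =>
    calc gal τ V = gal τ V * (R * V) := by rw [hRV, Matrix.mul_one]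
      _ = gal τ (V * R) * V := by rw [map_mul, hR, Matrix.mul_assoc]
      _ = V := by rw [hVR, map_one, Matrix.one_mul]
  induction a with
  | zero => rw [pow_zero, pow_zero, Matrix.one_mul, gal_one]
  | succ a ih => rw [pow_succ, gal_mul, hφX, map_mul, hφV, ih, ← Matrix.mul_assoc, ← pow_succ']

/-- **From a Frobenius solution to a congruence for every group element.** With `gal` as above
(indexed by a group), `Rc : Γ → M_N(A)` multiplicative with `gal τ (Rc σ) = Rc σ`, `V · Rc σ₀ = 1` and
`X = Rc σ₀ · gal σ₀ (X)`: if `gal σ X ≡ gal (σ₀ ^ a) X` and `Rc ((σ₀ ^ a)⁻¹ σ) ≡ 1` modulo `J`, then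
`X ≡ Rc σ · gal σ X (mod J)`. [folklore] -/
theorem MatCong.self_of_map_cong_of_cong_one [Group Γ]
    (gal : Γ → Matrix (Fin N) (Fin N) A →+* Matrix (Fin N) (Fin N) A)
    (gal_one : ∀ Y, gal 1 Y = Y) (gal_mul : ∀ σ τ Y, gal (σ * τ) Y = gal σ (gal τ Y))
    (Rc : Γ → Matrix (Fin N) (Fin N) A) (Rc_one : Rc 1 = 1) (Rc_mul : ∀ σ τ, Rc (σ * τ) = Rc σ * Rc τ)
    (hgal : ∀ τ σ, gal τ (Rc σ) = Rc σ) {σ₀ : Γ} {X V : Matrix (Fin N) (Fin N) A}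
    (hVR : V * Rc σ₀ = 1) (hX : X = Rc σ₀ * gal σ₀ X) {J : Ideal A} {σ : Γ} {a : ℕ}
    (h1 : MatCong J (gal σ X) (gal (σ₀ ^ a) X)) (h2 : MatCong J (Rc ((σ₀ ^ a)⁻¹ * σ)) 1) :
    MatCong J X (Rc σ * gal σ X) := by
  have hφpow := map_pow_eq_pow_mul_of_eq_mul_map gal gal_one gal_mul hVR (fun τ => hgal τ σ₀) hX a
  have hRpow : ∀ b : ℕ, Rc (σ₀ ^ b) = Rc σ₀ ^ b := fun b => by
    induction b with
    | zero => rw [pow_zero, pow_zero, Rc_one]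
    | succ b ih => rw [pow_succ, Rc_mul, ih, pow_succ]
  have hRV : Rc σ₀ * V = 1 := mul_eq_one_comm.1 hVR
  have hc : Commute (Rc σ₀) V := hRV.trans hVR.symm
  have hGpow : Rc (σ₀ ^ a) * V ^ a = 1 := by rw [hRpow, ← hc.mul_pow, hRV, one_pow]
  have key : Rc σ * gal σ X = Rc (σ₀ ^ a) * (Rc ((σ₀ ^ a)⁻¹ * σ) * gal σ X) := by
    rw [← Matrix.mul_assoc, ← Rc_mul, mul_inv_cancel_left]
  rw [key]
  have h3 : MatCong J (Rc ((σ₀ ^ a)⁻¹ * σ) * gal σ X) (gal (σ₀ ^ a) X) := by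
    have h := h2.mul_right (gal σ X)
    rw [Matrix.one_mul] at h
    exact h.trans h1
  have h4 := h3.mul_left (Rc (σ₀ ^ a))
  have h5 : Rc (σ₀ ^ a) * gal (σ₀ ^ a) X = X := by
    rw [hφpow, ← Matrix.mul_assoc, hGpow, Matrix.one_mul]
  rw [h5] at h4
  exact h4.symm

end Abstract

/-! ### `ℤ_p = W(𝔽_p) → W(k̄)` and the matrices `R(σ)` -/

variable [CharP (IsLocalRing.ResidueField (maxUnramifiedCompletion F)) p]

variable (F p) in
/-- **`ℤ_p → W(k̄)`**: `ℤ_p ≃ 𝕎(𝔽_p)` (Mathlib `WittVector.equiv`) followed by Witt functoriality of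
`𝔽_p → k̄`. [cite: SerreLocalFields1979, Ch. II §5 Prop. 10] -/
def padicIntToWitt : ℤ_[p] →+* WittVector p (IsLocalRing.ResidueField (maxUnramifiedCompletion F)) :=
  (WittVector.map (ZMod.castHom (dvd_refl p) (IsLocalRing.ResidueField (maxUnramifiedCompletion F)))).comp (WittVector.equiv p).symm.toRingHom

/-- The Galois action fixes the image of `ℤ_p` (ring maps out of `𝔽_p` are unique). [folklore] -/
@[simp] theorem wittGal_padicIntToWitt (σ : absoluteGaloisGroup F) (z : ℤ_[p]) :
    wittGal σ (padicIntToWitt F p z) = padicIntToWitt F p z := by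
  refine WittVector.ext fun n => ?_
  simp only [padicIntToWitt, wittGal, RingHom.comp_apply, WittVector.map_coeff]
  exact congrFun (congrArg DFunLike.coe
    (Subsingleton.elim ((residueGal σ).comp (ZMod.castHom (dvd_refl p) (IsLocalRing.ResidueField (maxUnramifiedCompletion F)))) (ZMod.castHom (dvd_refl p) (IsLocalRing.ResidueField (maxUnramifiedCompletion F))))) _

/-- **`W(k̄) → 𝔸_inf(F)` is a map of `ℤ_p`-algebras**: on `ℤ_p = W(𝔽_p)` it is the structure map
`zpToAinf` of `𝔸_inf(F)` (ring maps `ℤ_p → 𝔸_inf` are unique, `𝔸_inf` being `p`-adically separated: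
`padicInt_ringHom_ext_of_isHausdorff`, file `BdRPlusEmbedding`).
[cite: FontaineOuyang2022, §4.4] -/
theorem wittToAinf_padicIntToWitt [CharZero F] [Fact (¬ IsUnit (p : maxUnramifiedCompletion F))]
    [Fact (¬ IsUnit (p : integerC F))] (z : ℤ_[p]) : wittToAinf F p (padicIntToWitt F p z) = zpToAinf z :=
  congrArg (fun χ : ℤ_[p] →+* Ainf (p := p) F => χ z)
    (padicInt_ringHom_ext_of_isHausdorff ((wittToAinf F p).comp (padicIntToWitt F p)) zpToAinf)

/-- The Galois action fixes matrices with entries in the image of `ℤ_p`. [folklore] -/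
theorem wittGalMatrix_mapMatrix_padicIntToWitt (σ : absoluteGaloisGroup F) (A : Matrix (Fin N) (Fin N) ℤ_[p]) :
    wittGalMatrix σ ((padicIntToWitt F p).mapMatrix A) = (padicIntToWitt F p).mapMatrix A := by
  ext i j
  simp only [wittGalMatrix_apply, RingHom.mapMatrix_apply, Matrix.map_apply, wittGal_padicIntToWitt]

variable (r : absoluteGaloisGroup F →ₜ* GL (Fin N) ℤ_[p])

/-- The matrix `R(σ) ∈ M_N(W(k̄))` of `r σ`. [folklore] -/
def wittPeriodCoeff (σ : absoluteGaloisGroup F) : Matrix (Fin N) (Fin N) (WittVector p (IsLocalRing.ResidueField (maxUnramifiedCompletion F))) :=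
  (padicIntToWitt F p).mapMatrix ((r σ : GL (Fin N) ℤ_[p]) : Matrix (Fin N) (Fin N) ℤ_[p])

/-- Entries of `R(σ)`. [folklore] -/
@[simp] theorem wittPeriodCoeff_apply (σ : absoluteGaloisGroup F) (i j : Fin N) :
    wittPeriodCoeff (p := p) r σ i j = padicIntToWitt F p (((r σ : GL (Fin N) ℤ_[p]) : Matrix (Fin N) (Fin N) ℤ_[p]) i j) :=
  rfl

/-- `R(σ)` is invertible. [folklore] -/
theorem isUnit_wittPeriodCoeff (σ : absoluteGaloisGroup F) : IsUnit (wittPeriodCoeff (p := p) r σ) := by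
  rw [wittPeriodCoeff]
  exact ((r σ).isUnit).map (padicIntToWitt F p).mapMatrix

/-- `R(σ τ) = R(σ) R(τ)`. [folklore] -/
theorem wittPeriodCoeff_mul (σ τ : absoluteGaloisGroup F) :
    wittPeriodCoeff (p := p) r (σ * τ) = wittPeriodCoeff (p := p) r σ * wittPeriodCoeff (p := p) r τ := by
  simp only [wittPeriodCoeff, map_mul, Units.val_mul]

/-- `R(1) = 1`. [folklore] -/
theorem wittPeriodCoeff_one : wittPeriodCoeff (p := p) r 1 = 1 := by
  rw [wittPeriodCoeff, map_one, Units.val_one, map_one]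

/-- `τ(R(σ)) = R(σ)`. [folklore] -/
theorem wittGalMatrix_wittPeriodCoeff (τ σ : absoluteGaloisGroup F) :
    wittGalMatrix τ (wittPeriodCoeff (p := p) r σ) = wittPeriodCoeff (p := p) r σ := by
  rw [wittPeriodCoeff]
  exact wittGalMatrix_mapMatrix_padicIntToWitt τ _

/-- If `r τ ≡ 1 (mod p ^ m)` then `R(τ) ≡ 1 (mod p ^ m)`. [folklore] -/
theorem matCong_wittPeriodCoeff_one {m : ℕ} {τ : absoluteGaloisGroup F}
    (hτ : ∀ i j, ((r τ : GL (Fin N) ℤ_[p]) : Matrix (Fin N) (Fin N) ℤ_[p]) i j - (1 : Matrix (Fin N) (Fin N) ℤ_[p]) i j ∈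
      Ideal.span {(p : ℤ_[p]) ^ m}) :
    MatCong (Ideal.span {(p : WittVector p (IsLocalRing.ResidueField (maxUnramifiedCompletion F)))} ^ m) (wittPeriodCoeff (p := p) r τ) 1 := by
  intro i j
  obtain ⟨z, hz⟩ := Ideal.mem_span_singleton'.1 (hτ i j)
  have : wittPeriodCoeff (p := p) r τ i j - (1 : Matrix (Fin N) (Fin N) (WittVector p (IsLocalRing.ResidueField (maxUnramifiedCompletion F)))) i j =
      padicIntToWitt F p (((r τ : GL (Fin N) ℤ_[p]) : Matrix (Fin N) (Fin N) ℤ_[p]) i j -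
        (1 : Matrix (Fin N) (Fin N) ℤ_[p]) i j) := by
    simp only [wittPeriodCoeff, RingHom.mapMatrix_apply, Matrix.map_apply, map_sub, Matrix.one_apply]
    split_ifs <;> simp
  rw [this, ← hz, map_mul, map_pow, map_natCast, Ideal.span_singleton_pow]
  exact Ideal.mul_mem_left _ _ (Ideal.mem_span_singleton_self _)

/-! ### Lang's theorem over `W(k̄)` for an arithmetic Frobenius -/

/-- **Lang's theorem over `W(k̄)`**: for an arithmetic Frobenius `σ₀` and invertible `G ∈ M_N(W(k̄))`
there is an invertible `X` with `X = G · 𝕎(σ̄₀)(X)` (`W(k̄)` is `p`-adically complete with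
algebraically closed residue field on which `σ̄₀` is `y ↦ y^q`). [cite: SerreLocalFields1979, Ch. XIII §5] -/
theorem IsAbsArithFrob.exists_isUnit_eq_mul_wittGal {σ₀ : absoluteGaloisGroup F} (hσ₀ : IsAbsArithFrob σ₀)
    {G : Matrix (Fin N) (Fin N) (WittVector p (IsLocalRing.ResidueField (maxUnramifiedCompletion F)))} (hG : IsUnit G) :
    ∃ X : Matrix (Fin N) (Fin N) (WittVector p (IsLocalRing.ResidueField (maxUnramifiedCompletion F))),
      IsUnit X ∧ X = G * wittGalMatrix σ₀ X := by
  have hres : Function.Surjective (WittVector.constantCoeff :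
      WittVector p (IsLocalRing.ResidueField (maxUnramifiedCompletion F)) →+*
        IsLocalRing.ResidueField (maxUnramifiedCompletion F)) := fun y => ⟨teichmuller p y, by simp⟩
  have hker : ∀ x : WittVector p (IsLocalRing.ResidueField (maxUnramifiedCompletion F)),
      WittVector.constantCoeff x = 0 ↔
        x ∈ Ideal.span {(p : WittVector p (IsLocalRing.ResidueField (maxUnramifiedCompletion F)))} := by
    intro x
    rw [WittVector.constantCoeff_apply, WittVector.mem_span_p_iff_coeff_zero_eq_zero]
  have hcomp : ∀ x : WittVector p (IsLocalRing.ResidueField (maxUnramifiedCompletion F)),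
      WittVector.constantCoeff (wittGal (p := p) σ₀ x) = residueGal σ₀ (WittVector.constantCoeff x) := by
    intro x
    rw [WittVector.constantCoeff_apply, WittVector.constantCoeff_apply, coeff_wittGal]
  have hπ : wittGal (F := F) (p := p) σ₀
      (p : WittVector p (IsLocalRing.ResidueField (maxUnramifiedCompletion F))) = p := map_natCast _ p
  exact FrobeniusSemilinear.exists_isUnit_eq_mul_map
    (p : WittVector p (IsLocalRing.ResidueField (maxUnramifiedCompletion F))) (wittGal (p := p) σ₀)
    WittVector.constantCoeff (residueGal σ₀) hres hker
    (IsAbsArithFrob.residueGal_eq_pow hσ₀) (one_lt_residueFieldCard F) hπ hcomp hG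

/-! ### The period matrix -/

/-- If two ring endomorphisms of `k̄` agree on the components below `m` of a Witt vector `x`, the
images of `x` agree modulo `p ^ m`. [folklore] -/
theorem map_sub_map_mem_span_pow {f g : (IsLocalRing.ResidueField (maxUnramifiedCompletion F)) →+* (IsLocalRing.ResidueField (maxUnramifiedCompletion F))} {x : WittVector p (IsLocalRing.ResidueField (maxUnramifiedCompletion F))} {m : ℕ}
    (h : ∀ t < m, f (x.coeff t) = g (x.coeff t)) :
    WittVector.map f x - WittVector.map g x ∈ Ideal.span {(p : WittVector p (IsLocalRing.ResidueField (maxUnramifiedCompletion F)))} ^ m := by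
  rw [Ideal.span_singleton_pow, WittVector.mem_span_p_pow_iff_le_coeff_eq_zero]
  refine (WittVector.le_coeff_eq_iff_le_sub_coeff_eq_zero).1 fun t ht => ?_
  rw [WittVector.map_coeff, WittVector.map_coeff, h t ht]

/-- If `σ̄` and `σ̄'` agree on the Witt components of `X` below `m`, then `𝕎(σ̄)(X) ≡ 𝕎(σ̄')(X) (mod p ^ m)`.
[folklore] -/
theorem matCong_wittGalMatrix_of_forall_coeff {σ σ' : absoluteGaloisGroup F}
    {X : Matrix (Fin N) (Fin N) (WittVector p (IsLocalRing.ResidueField (maxUnramifiedCompletion F)))} {m : ℕ}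
    (h : ∀ (i j : Fin N) (t : ℕ), t < m → residueGal σ ((X i j).coeff t) = residueGal σ' ((X i j).coeff t)) :
    MatCong (Ideal.span {(p : WittVector p (IsLocalRing.ResidueField (maxUnramifiedCompletion F)))} ^ m)
      (wittGalMatrix σ X) (wittGalMatrix σ' X) := fun i j => by
  rw [wittGalMatrix_apply, wittGalMatrix_apply, wittGal, wittGal]
  exact map_sub_map_mem_span_pow (h i j)

/-- **The period matrix of an unramified `p`-adic representation over `W(k̄)`.** For a continuous
unramified `r : Gal(F̄/F) → GL_N(ℤ_p)` there is an invertible `X ∈ M_N(W(k̄))` with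
`X = R(σ) · 𝕎(σ̄)(X)` for every `σ ∈ Gal(F̄/F)`: the semilinear `Gal(F̄/F)`-module `W(k̄)^N`,
`w ↦ R(σ) σ(w)`, has a basis of invariant vectors (unramified representations are
`W(k̄)[1/p]`-admissible; Fontaine 1994, Exp. III §1.5–1.6; Fontaine–Ouyang Prop. 2.14, Thm. 2.13;
Lang's theorem over `W(k̄)` plus the density of Frobenius powers modulo inertia).
[cite: FontaineAsterisque223III, Exp. III §1.5] [cite: SerreLocalFields1979, Ch. XIII §5] -/
theorem exists_isUnit_forall_eq_mul_wittGal (hr : ∀ σ ∈ absInertia F, r σ = 1) :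
    ∃ X : Matrix (Fin N) (Fin N) (WittVector p (IsLocalRing.ResidueField (maxUnramifiedCompletion F))), IsUnit X ∧
      ∀ σ : absoluteGaloisGroup F, X = wittPeriodCoeff (p := p) r σ * wittGalMatrix σ X := by
  classical
  obtain ⟨σ₀, hσ₀⟩ := exists_isAbsArithFrob_holds (F := F)
  obtain ⟨X, hXu, hX⟩ := IsAbsArithFrob.exists_isUnit_eq_mul_wittGal hσ₀ (isUnit_wittPeriodCoeff (p := p) r σ₀)
  refine ⟨X, hXu, fun σ => ?_⟩
  obtain ⟨V, hVR⟩ := (isUnit_wittPeriodCoeff (p := p) r σ₀).exists_left_inv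
  -- congruence modulo `p ^ m` for every `m`
  refine MatCong.eq_of_forall_pow (I := Ideal.span {(p : WittVector p (IsLocalRing.ResidueField (maxUnramifiedCompletion F)))}) fun m => ?_
  -- lift the Witt components of `X` below `m` to `𝒪_{F^nr} ⊆ F̄`
  choose b hb using fun y : (IsLocalRing.ResidueField (maxUnramifiedCompletion F)) => exists_residue_algebraMap_eq y
  -- the open set `U = {τ | r τ ≡ 1 mod p ^ m}` contains inertia; apply the density lemma
  have hIU : (absInertia F : Set (absoluteGaloisGroup F)) ⊆ {τ : absoluteGaloisGroup F | ∀ i j,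
      ((r τ : GL (Fin N) ℤ_[p]) : Matrix (Fin N) (Fin N) ℤ_[p]) i j - (1 : Matrix (Fin N) (Fin N) ℤ_[p]) i j ∈
        Ideal.span {(p : ℤ_[p]) ^ m}} := by
    intro τ hτ i j
    rw [hr τ hτ, Units.val_one, sub_self]
    exact zero_mem _
  obtain ⟨a, haT, haU⟩ := exists_forall_smul_eq_pow_and_mem hσ₀ σ
    (Finset.univ.image fun ijt : Fin N × Fin N × Fin m =>
      ((b ((X ijt.1 ijt.2.1).coeff (ijt.2.2 : ℕ)) : maxUnramifiedIntegers F) : AlgebraicClosure F))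
    (by
      intro t ht
      obtain ⟨ijt, -, rfl⟩ := Finset.mem_image.1 ht
      exact mem_maxUnramified_of_mem (b _).2)
    (isOpen_setOf_congr r m) hIU
  -- Step 1: `σ̄` and `σ̄₀ ^ a` agree on the components of `X` below `m`, so `σ(X) ≡ σ₀ ^ a (X)`
  have hcomp : ∀ (i j : Fin N) (t : ℕ), t < m →
      residueGal σ ((X i j).coeff t) = residueGal (σ₀ ^ a) ((X i j).coeff t) := by
    intro i j t ht
    rw [← hb ((X i j).coeff t), residueGal_residue_algebraMap, residueGal_residue_algebraMap]
    congr 2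
    refine Subtype.ext ?_
    rw [maxUnramifiedIntegers.coe_smul, maxUnramifiedIntegers.coe_smul]
    exact haT _ (Finset.mem_image.2 ⟨(i, j, ⟨t, ht⟩), Finset.mem_univ _, rfl⟩)
  -- Step 2: `R((σ₀ ^ a)⁻¹ σ) ≡ 1`; combine
  exact MatCong.self_of_map_cong_of_cong_one
    (A := WittVector p (IsLocalRing.ResidueField (maxUnramifiedCompletion F))) (Γ := absoluteGaloisGroup F)
    (wittGalMatrix (F := F) (p := p) (N := N)) (wittGalMatrix_one (F := F) (p := p) (N := N))
    (wittGalMatrix_mul (F := F) (p := p) (N := N))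
    (wittPeriodCoeff (p := p) r) (wittPeriodCoeff_one (p := p) r) (wittPeriodCoeff_mul (p := p) r)
    (fun τ σ' => wittGalMatrix_wittPeriodCoeff (p := p) r τ σ') hVR hX
    (matCong_wittGalMatrix_of_forall_coeff (F := F) (p := p) hcomp) (matCong_wittPeriodCoeff_one (p := p) r haU)


/-! ### Unramified representations are `B`-admissible for every period ring receiving `W(k̄)` -/

section Admissible

variable [Algebra ℚ_[p] F]

universe w w'

open TensorProduct in
-- Mathlib's own global value of `maxSynthPendingDepth` (the project default `1` makes nested
-- instance problems on `𝔅.B ⊗[P] M` fail spuriously; see `PeriodRingData.rank_D_le`).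
set_option maxSynthPendingDepth 3 in
/-- **Unramified representations are `B`-admissible for every period ring `B` receiving `W(k̄)`.**
Let `𝔅` be a period-ring datum for `Γ_F` over `ℚ_p` with invariants `F`, and `ι : W(k̄) → B` a
`Γ_F`-equivariant ring map with `ι ∘ (ℤ_p → W(k̄)) = (ℚ_p → B) ∘ (ℤ_p → ℚ_p)`.  Then every continuous
representation `ρ` of `Γ_F` on a finite-dimensional Hausdorff topological `ℚ_p`-vector space `V` with
`ρ|_{I_F} = 1` satisfies `dim_F (B ⊗_{ℚ_p} V)^{Γ_F} = dim_{ℚ_p} V` (Fontaine 1994, Exp. III §1.5 and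
Prop. 1.6.2; Fontaine–Ouyang Prop. 2.14: unramified representations are `K̂₀^nr`-admissible — Lang's
theorem over `W(k̄)`). [cite: FontaineAsterisque223III, Exp. III §1.5] -/
theorem PeriodRingData.isAdmissible_of_unramified_witt
    (𝔅 : PeriodRingData.{0, 0, 0, w} (absoluteGaloisGroup F) ℚ_[p] F)
    (ι : WittVector p (ResidueField (maxUnramifiedCompletion F)) →+* 𝔅.B)
    (hισ : ∀ (σ : absoluteGaloisGroup F) (x : WittVector p (ResidueField (maxUnramifiedCompletion F))),
      σ • ι x = ι (wittGal σ x))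
    (hιp : ∀ z : ℤ_[p], ι (padicIntToWitt F p z) = algebraMap ℚ_[p] 𝔅.B (z : ℚ_[p]))
    {V : Type w'} [AddCommGroup V] [Module ℚ_[p] V] [TopologicalSpace V] [IsTopologicalAddGroup V]
    [ContinuousSMul ℚ_[p] V] [T2Space V] [FiniteDimensional ℚ_[p] V]
    (ρ : ContinuousRep (absoluteGaloisGroup F) ℚ_[p] V)
    (hρ : ∀ σ ∈ absInertia F, ∀ v : V, ρ σ v = v) :
    𝔅.IsAdmissible ρ := by
  classical
  haveI : CompactSpace (absoluteGaloisGroup F) := absoluteGaloisGroup_compactSpace F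
  set N := Module.finrank ℚ_[p] V with hN
  -- an integral frame
  obtain ⟨b, r, hbr⟩ := ρ.exists_basis_integralFrame
  -- `r` is unramified
  have hr : ∀ σ ∈ absInertia F, r σ = 1 := by
    intro σ hσ
    refine Units.ext (Matrix.ext fun i j => PadicInt.ext ?_)
    have h1 := hbr σ j
    rw [hρ σ hσ] at h1
    have h2 := congrArg (fun v => b.repr v i) h1
    simp only [b.repr_sum_self, b.repr_self_apply] at h2
    rw [← h2, Units.val_one, Matrix.one_apply]
    by_cases hij : i = j
    · subst hij; simp
    · rw [if_neg (Ne.symm hij), if_neg hij, PadicInt.coe_zero]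
  -- the period matrix over `W(k̄)` and its image `Y` in `B`
  obtain ⟨X, hXu, hX⟩ := exists_isUnit_forall_eq_mul_wittGal (p := p) r hr
  set Y : Matrix (Fin N) (Fin N) 𝔅.B := ι.mapMatrix X with hYdef
  have hYapply : ∀ i j, Y i j = ι (X i j) := fun i j => rfl
  have hY : ∀ (σ : absoluteGaloisGroup F) (k j : Fin N),
      Y k j = ∑ i, (((r σ : GL (Fin N) ℤ_[p]) : Matrix (Fin N) (Fin N) ℤ_[p]) k i : ℚ_[p]) • σ • Y i j := by
    intro σ k j
    have h := congrArg (fun M : Matrix (Fin N) (Fin N) (WittVector p (ResidueField (maxUnramifiedCompletion F))) =>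
      ι (M k j)) (hX σ)
    simp only [Matrix.mul_apply, map_sum, map_mul] at h
    rw [hYapply, h]
    refine Finset.sum_congr rfl fun i _ => ?_
    rw [wittPeriodCoeff_apply, wittGalMatrix_apply, hιp, ← hισ, hYapply, Algebra.smul_def]
  -- the invariant vectors
  let w : Fin N → 𝔅.B ⊗[ℚ_[p]] V := fun j => ∑ i, Y i j ⊗ₜ[ℚ_[p]] b i
  have hwD : ∀ j, w j ∈ 𝔅.D ρ := by
    intro j
    rw [PeriodRingData.mem_D_iff]
    intro σ
    simp only [w, map_sum, PeriodRingData.tensorRep_apply_tmul]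
    calc ∑ i, (σ • Y i j) ⊗ₜ[ℚ_[p]] ρ σ (b i)
        = ∑ i, ∑ k, ((((r σ : GL (Fin N) ℤ_[p]) : Matrix (Fin N) (Fin N) ℤ_[p]) k i : ℚ_[p]) • σ • Y i j) ⊗ₜ[ℚ_[p]] b k := by
          refine Finset.sum_congr rfl fun i _ => ?_
          rw [hbr σ i, TensorProduct.tmul_sum]
          refine Finset.sum_congr rfl fun k _ => ?_
          exact (TensorProduct.smul_tmul _ _ _).symm
      _ = ∑ k, (∑ i, (((r σ : GL (Fin N) ℤ_[p]) : Matrix (Fin N) (Fin N) ℤ_[p]) k i : ℚ_[p]) • σ • Y i j) ⊗ₜ[ℚ_[p]] b k := by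
          rw [Finset.sum_comm]
          refine Finset.sum_congr rfl fun k _ => ?_
          rw [TensorProduct.sum_tmul]
      _ = ∑ k, Y k j ⊗ₜ[ℚ_[p]] b k := Finset.sum_congr rfl fun k _ => by rw [← hY σ k j]
  -- they are linearly independent over `B`, hence over `F`
  let β : Module.Basis (Fin N) 𝔅.B (𝔅.B ⊗[ℚ_[p]] V) := Algebra.TensorProduct.basis 𝔅.B b
  have hYdet : IsUnit Y.det := (Matrix.isUnit_iff_isUnit_det _).1 (hXu.map ι.mapMatrix)
  have hw : ∀ j, w j = Matrix.toLin β β Y (β j) := by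
    intro j
    rw [Matrix.toLin_self]
    refine Finset.sum_congr rfl fun i _ => ?_
    rw [Algebra.TensorProduct.basis_apply, TensorProduct.smul_tmul', smul_eq_mul, mul_one]
  have hliB : LinearIndependent 𝔅.B w := by
    have h := β.linearIndependent.map' (Matrix.toLin β β Y) (Matrix.ker_toLin_eq_bot β Y hYdet)
    rw [show w = ⇑(Matrix.toLin β β Y) ∘ ⇑β from funext hw]
    exact h
  have hliF : LinearIndependent F w := by
    refine hliB.restrict_scalars ?_
    intro x y hxy
    have h : algebraMap F 𝔅.B x = algebraMap F 𝔅.B y := by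
      simpa only [Algebra.smul_def, mul_one] using hxy
    exact (algebraMap F 𝔅.B).injective h
  -- count dimensions
  have hliD : LinearIndependent F (fun j => (⟨w j, hwD j⟩ : 𝔅.D ρ)) :=
    LinearIndependent.of_comp (𝔅.D ρ).subtype (by exact hliF)
  have h1 : (N : Cardinal) ≤ Module.rank F (𝔅.D ρ) := by
    simpa using hliD.cardinal_lift_le_rank
  have h2 : Module.rank F (𝔅.D ρ) ≤ N := 𝔅.rank_D_le ρ
  exact Module.finrank_eq_of_rank_eq (le_antisymm h2 h1)


end Admissible

end Literature.NumberTheory.PAdicHodge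

end
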